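import Summits.CriticalPhenomena.PercolationContinuityZ3.Theorems.Transplant.SharpnessGridWedge
import Literature.Barriers.CriticalPhenomena.SubexponentialGrowthZd
import HarnessLib

/-!
# Transplant sharpness XXXV — every subgraph of `ℤ^d` has polynomial volume growth (so `W` and `G′` have quadratic growth)

builds on p205010 (kernel theorem, internal audit signed; external expert review pending).
Status sentence (coordinator 2026-08-20T04:30Z): "θ(p_c) = 0 on ℤ^d, all d ≥ 2 — kernel-verified (Lean 4/Mathlib,
standard axioms); internal adversarial audit SIGNED 2026-08-20 04:29Z; external expert review pending."

Lane `prim-bschramm`, seat p5 (sharpness); memo `run/shared/lean/prim/bschramm/P5-SHARPNESS.md` §2 rows 5 and 83 (columns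
"growth" / "amenable side").  In the tree's growth vocabulary (`Literature.Barriers.CriticalPhenomena.graphBall`, `ballVolume`,
`HasExponentialGrowth` of `SubexponentialGrowthZd`):

* `ballVolume_induce_zd_le` — for every `S ⊆ ℤ^d`, EVERY vertex `x` of `ℤ^d[S]` and every `n`: `|B_{ℤ^d[S]}(x, n)| ≤ (2n+1)^d`
  (a walk of `ℤ^d[S]` is a walk of `ℤ^d`, whose coordinates move by at most its length: `abs_sub_le_length_of_walk`);
* `not_hasExponentialGrowth_induce_zd` — hence no nonempty induced subgraph of `ℤ^d` has exponential growth;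
* `ballVolume_gridWedge_le`, `gridWedge_not_hasExponentialGrowth`, `ballVolume_logWedge_le` — the gridded wedge `G′_M` and
  Grimmett's wedge `W` have (at most) quadratic growth AT EVERY VERTEX: the "polynomial growth" column of rows 83 / 5.
  (The tree's `TreesPercolatingAtCriticality` already has the origin-centred `ballVolume_induce_zdGraph_le`,
  `not_hasExponentialGrowth_induce_zdGraph` and `logWedgeGraph_not_hasExponentialGrowth`; the every-centre bound here is what
  the Følner argument of `SharpnessSubgraphAmenable` needs.)

References: M. Heydenreich, R. van der Hofstad (2017), (15.6.6); T. Hutchcroft (2016), §1; G. Grimmett, *Percolation* (1999), §11.5.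
-/

noncomputable section

namespace Summit.CriticalPhenomena.PercolationContinuityZ3.Theorems.TransplantSharpness

open Literature.Probability.LatticeModels Literature.Barriers.CriticalPhenomena

/-! ## Induced subgraphs of `ℤ^d` -/

section Induce

variable {d : ℕ} {S : Set (Site d)}

/-- A vertex at walk-distance `≤ n` from `x` in `ℤ^d[S]` lies in the `ℓ^∞`-box of radius `n` around `x`. [folklore] -/
theorem mem_box_of_mem_graphBall_induce (x : S) {n : ℕ} {y : S} (hy : y ∈ graphBall ((zdGraph d).induce S) x n) :
    (y : Site d) - (x : Site d) ∈ box d n := by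
  obtain ⟨w, hw⟩ := hy
  rw [mem_box]
  intro i
  have h := abs_sub_le_length_of_walk (w.map (SimpleGraph.Embedding.induce S).toHom) i
  rw [SimpleGraph.Walk.length_map] at h
  change |(y : Site d) i - (x : Site d) i| ≤ (w.length : ℤ) at h
  have hn : (w.length : ℤ) ≤ n := by exact_mod_cast hw
  have h' := (abs_le.1 (h.trans hn))
  simp only [Pi.sub_apply]
  constructor <;> linarith [h'.1, h'.2]

/-- **Polynomial growth of every subgraph of `ℤ^d`**: `|B_{ℤ^d[S]}(x,n)| ≤ (2n+1)^d`.
[cite: HeydenreichVanDerHofstad2017, (15.6.6)] -/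
theorem ballVolume_induce_zd_le (x : S) (n : ℕ) : ballVolume ((zdGraph d).induce S) x n ≤ (2 * n + 1) ^ d := by
  classical
  rw [ballVolume, ← card_box d n, ← Set.ncard_coe_finset]
  -- inject the ball into the box via `y ↦ y - x`
  have hinj : Set.InjOn (fun y : S => (y : Site d) - (x : Site d)) (graphBall ((zdGraph d).induce S) x n) := by
    intro y _ z _ h
    exact Subtype.ext (sub_left_injective h)
  calc (graphBall ((zdGraph d).induce S) x n).ncard
      = ((fun y : S => (y : Site d) - (x : Site d)) '' graphBall ((zdGraph d).induce S) x n).ncard :=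
        hinj.ncard_image.symm
    _ ≤ (↑(box d n) : Set (Site d)).ncard := by
        refine Set.ncard_le_ncard ?_ (box d n).finite_toSet
        rintro _ ⟨y, hy, rfl⟩
        exact Finset.mem_coe.2 (mem_box_of_mem_graphBall_induce x hy)

/-- **No nonempty induced subgraph of `ℤ^d` has exponential growth.** [cite: HeydenreichVanDerHofstad2017, (15.6.6)] -/
theorem not_hasExponentialGrowth_induce_zd (x : S) : ¬ HasExponentialGrowth ((zdGraph d).induce S) := by
  intro h
  obtain ⟨c, hc, hev⟩ := h x
  obtain ⟨n, hn1, hn2⟩ := (hev.and (eventually_pow_lt_const_pow d hc)).exists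
  have hvol : (ballVolume ((zdGraph d).induce S) x n : ℝ) ≤ (2 * n + 1) ^ d := by
    exact_mod_cast ballVolume_induce_zd_le x n
  linarith

end Induce

/-! ## The wedges of rows 5 and 83 -/

variable {a b : ℝ} {M : ℕ}

/-- **Quadratic growth of the gridded wedge**: `|B_{G′}(x,n)| ≤ (2n+1)²`. [folklore] -/
theorem ballVolume_gridWedge_le (x : gridWedge a b M) (n : ℕ) :
    ballVolume (gridWedgeGraph a b M) x n ≤ (2 * n + 1) ^ 2 :=
  ballVolume_induce_zd_le x n

/-- The gridded wedge does not have exponential growth. [folklore] -/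
theorem gridWedge_not_hasExponentialGrowth (a b : ℝ) (M : ℕ) : ¬ HasExponentialGrowth (gridWedgeGraph a b M) :=
  not_hasExponentialGrowth_induce_zd (gridWedgeOrigin a b M)

/-- **Quadratic growth of Grimmett's wedge at every vertex**: `|B_W(x,n)| ≤ (2n+1)²` (the tree's
`ballVolume_induce_zdGraph_le` / `logWedgeGraph_not_hasExponentialGrowth` of `TreesPercolatingAtCriticality` give the
origin-centred bound and the growth statement for `W`; this is the every-centre form). [folklore] -/
theorem ballVolume_logWedge_le (x : logWedge a b) (n : ℕ) :
    ballVolume (logWedgeGraph a b) x n ≤ (2 * n + 1) ^ 2 :=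
  ballVolume_induce_zd_le x n

end Summit.CriticalPhenomena.PercolationContinuityZ3.Theorems.TransplantSharpness

end
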